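import Literature.Probability.LatticeModels.LatticeSineGordon

/-!
# Crux `AnchorGap` (stmt-QuantumFields-11141), line `registered` — discrete Poincaré inequality on the torus (soft layer under stub DSred)

Towards removing the regulator `ε` entirely from the remaining core of stub DSred
(`stub_debyeScreening`): at `ε = 0` the lattice sine-Gordon weight
(`Literature.Probability.LatticeModels.LatticeSineGordon.weight α g 0 ζ`) controls only the
gradient energy `Σ (∇φ)²`, and integrability on the zero-mode cell `{θ̄ ∈ D_b}` needs the
fluctuation `φ − θ̄` to be controlled by the gradient.  Elementary torus geometry gives this with a
crude (volume-dependent, which is all the fixed-volume step needs) constant: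

* `torus_increment_sq_le` — `(φ(x + m eᵢ) − φ(x))² ≤ m² Σ(∇φ)²` (telescoping + Cauchy–Schwarz);
* `torus_diff_sq_le` — `(φ(y) − φ(x))² ≤ (dN)² Σ(∇φ)²` (coordinate path, `z = Σ_i (z_i).val • eᵢ`);
* `torus_poincare` — `Σ_p (φ_p − θ̄_{p.2})² ≤ V k (dN)² Σ(∇φ)²`;
* `sum_sq_sub_zeroMode` — the variance identity `Σ_p φ_p² − V|θ̄|² = Σ_p (φ_p − θ̄_{p.2})²` (the
  regulator `ε Σ φ²` is exactly `ε V|θ̄|²` on the zero mode plus `ε ‖φ − θ̄‖²` on the fluctuation).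
-/

set_option autoImplicit false

noncomputable section

namespace Summit.QuantumFields.YangMills.Theorems.AnchorGap

open MeasureTheory Finset
open Literature.Probability.LatticeModels

/-- Every torus site is the sum of its coordinate steps: `z = Σ_i (z i).val • eᵢ`. -/
private lemma torus_decomp {d N : ℕ} [NeZero N] (z : TorusSite d N) :
    ∑ i : Fin d, (z i).val • (Pi.single i (1 : ZMod N) : TorusSite d N) = z := by
  funext j
  rw [Finset.sum_apply]
  simp only [Pi.smul_apply, Pi.single_apply, smul_ite, smul_zero, nsmul_eq_mul, mul_one, ZMod.natCast_zmod_val]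
  rw [Finset.sum_ite_eq]
  simp

/-- **Increments along a coordinate direction are controlled by the gradient energy**:
`(φ(x + m eᵢ, a) − φ(x, a))² ≤ m² Σ_{y,j,a'} (φ(y + e_j, a') − φ(y, a'))²` (telescoping over `m` steps
and Cauchy–Schwarz). [folklore] -/
theorem torus_increment_sq_le :
    ∀ (d N k : ℕ) [NeZero N] (φ : LatticeSineGordon.Config d N k) (x : TorusSite d N) (i : Fin d) (a : Fin k) (m : ℕ), (φ (x + m • Pi.single i 1, a) - φ (x, a)) ^ 2 ≤ (m : ℝ) ^ 2 * ∑ y : TorusSite d N, ∑ j : Fin d, ∑ a' : Fin k, (φ (y + Pi.single j 1, a') - φ (y, a')) ^ 2 := by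
  intro d N k _ φ x i a m
  set G : ℝ := ∑ y : TorusSite d N, ∑ j : Fin d, ∑ a' : Fin k, (φ (y + Pi.single j 1, a') - φ (y, a')) ^ 2 with hG
  -- telescoping
  set f : ℕ → ℝ := fun j => φ (x + j • Pi.single i 1, a) with hf
  have htel : φ (x + m • Pi.single i 1, a) - φ (x, a) = ∑ j ∈ Finset.range m, (f (j + 1) - f j) := by
    rw [Finset.sum_range_sub, hf]
    simp
  -- each step is one term of the gradient energy
  have hstep : ∀ j : ℕ, (f (j + 1) - f j) ^ 2 ≤ G := by
    intro j
    have h1 : f (j + 1) - f j = φ ((x + j • Pi.single i 1) + Pi.single i 1, a) - φ (x + j • Pi.single i 1, a) := by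
      rw [hf]
      simp only [succ_nsmul, add_assoc]
    rw [h1, hG]
    have := Finset.single_le_sum (f := fun y : TorusSite d N => ∑ j : Fin d, ∑ a' : Fin k,
        (φ (y + Pi.single j 1, a') - φ (y, a')) ^ 2)
      (fun y _ => sum_nonneg fun _ _ => sum_nonneg fun _ _ => sq_nonneg _) (Finset.mem_univ (x + j • Pi.single i 1))
    refine le_trans ?_ this
    have := Finset.single_le_sum (f := fun j' : Fin d => ∑ a' : Fin k,
        (φ ((x + j • Pi.single i 1) + Pi.single j' 1, a') - φ (x + j • Pi.single i 1, a')) ^ 2)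
      (fun _ _ => sum_nonneg fun _ _ => sq_nonneg _) (Finset.mem_univ i)
    refine le_trans ?_ this
    exact Finset.single_le_sum (f := fun a' : Fin k =>
        (φ ((x + j • Pi.single i 1) + Pi.single i 1, a') - φ (x + j • Pi.single i 1, a')) ^ 2)
      (fun _ _ => sq_nonneg _) (Finset.mem_univ a)
  rw [htel]
  calc (∑ j ∈ Finset.range m, (f (j + 1) - f j)) ^ 2
      ≤ (Finset.range m).card * ∑ j ∈ Finset.range m, (f (j + 1) - f j) ^ 2 := sq_sum_le_card_mul_sum_sq
    _ ≤ (m : ℝ) * ∑ _j ∈ Finset.range m, G := by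
        rw [Finset.card_range]
        exact mul_le_mul_of_nonneg_left (Finset.sum_le_sum fun j _ => hstep j) (by positivity)
    _ = (m : ℝ) ^ 2 * G := by
        rw [Finset.sum_const, Finset.card_range, nsmul_eq_mul]; ring

/-- **Differences of the field between any two sites are controlled by the gradient energy**:
`(φ(y,a) − φ(x,a))² ≤ (dN)² Σ (∇φ)²` on the torus `(ℤ/N)^d` (coordinate path of length `< dN`,
`torus_increment_sq_le`). [folklore] -/
theorem torus_diff_sq_le :
    ∀ (d N k : ℕ) [NeZero N] (φ : LatticeSineGordon.Config d N k) (x y : TorusSite d N) (a : Fin k), (φ (y, a) - φ (x, a)) ^ 2 ≤ ((d : ℝ) * N) ^ 2 * ∑ z : TorusSite d N, ∑ j : Fin d, ∑ a' : Fin k, (φ (z + Pi.single j 1, a') - φ (z, a')) ^ 2 := by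
  intro d N k _ φ x y a
  classical
  set G : ℝ := ∑ z : TorusSite d N, ∑ j : Fin d, ∑ a' : Fin k, (φ (z + Pi.single j 1, a') - φ (z, a')) ^ 2 with hG
  have hG0 : 0 ≤ G := sum_nonneg fun _ _ => sum_nonneg fun _ _ => sum_nonneg fun _ _ => sq_nonneg _
  set m : Fin d → ℕ := fun i => ((y - x) i).val with hm
  have hmN : ∀ i, (m i : ℝ) ≤ N := fun i => by
    rw [hm]; exact_mod_cast (ZMod.val_lt _).le
  -- partial paths `x_S = x + Σ_{i ∈ S} m_i eᵢ`
  have hpath : ∀ S : Finset (Fin d),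
      |φ (x + ∑ i ∈ S, m i • Pi.single i 1, a) - φ (x, a)| ≤ S.card * N * Real.sqrt G := by
    intro S
    induction S using Finset.induction_on with
    | empty => simp
    | insert i S hi ih =>
      rw [Finset.sum_insert hi, Finset.card_insert_of_notMem hi]
      have hinc := torus_increment_sq_le d N k φ (x + ∑ i ∈ S, m i • Pi.single i 1) i a (m i)
      have hinc' : |φ (x + ∑ i ∈ S, m i • Pi.single i 1 + m i • Pi.single i 1, a) -
          φ (x + ∑ i ∈ S, m i • Pi.single i 1, a)| ≤ m i * Real.sqrt G := by
        have h := Real.abs_le_sqrt hinc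
        rwa [Real.sqrt_mul (sq_nonneg _), Real.sqrt_sq (by positivity)] at h
      have hrew : x + (m i • Pi.single i 1 + ∑ i ∈ S, m i • Pi.single i 1) =
          x + ∑ i ∈ S, m i • Pi.single i 1 + m i • Pi.single i 1 := by abel
      rw [hrew]
      calc |φ (x + ∑ i ∈ S, m i • Pi.single i 1 + m i • Pi.single i 1, a) - φ (x, a)|
          ≤ |φ (x + ∑ i ∈ S, m i • Pi.single i 1 + m i • Pi.single i 1, a) - φ (x + ∑ i ∈ S, m i • Pi.single i 1, a)| +
            |φ (x + ∑ i ∈ S, m i • Pi.single i 1, a) - φ (x, a)| := abs_sub_le _ _ _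
        _ ≤ m i * Real.sqrt G + S.card * N * Real.sqrt G := add_le_add hinc' ih
        _ ≤ N * Real.sqrt G + S.card * N * Real.sqrt G := by
            have := mul_le_mul_of_nonneg_right (hmN i) (Real.sqrt_nonneg G)
            linarith
        _ = ((S.card + 1 : ℕ) : ℝ) * N * Real.sqrt G := by push_cast; ring
  have hfull := hpath Finset.univ
  rw [Finset.card_univ, Fintype.card_fin] at hfull
  have hy : x + ∑ i : Fin d, m i • (Pi.single i (1 : ZMod N) : TorusSite d N) = y := by
    rw [hm, torus_decomp (y - x)]; abel
  rw [hy] at hfull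
  have h2 := pow_le_pow_left₀ (abs_nonneg _) hfull 2
  rw [sq_abs] at h2
  calc (φ (y, a) - φ (x, a)) ^ 2 ≤ ((d : ℝ) * N * Real.sqrt G) ^ 2 := h2
    _ = ((d : ℝ) * N) ^ 2 * G := by rw [mul_pow, Real.sq_sqrt hG0]

/-- **Discrete Poincaré inequality on the torus** (crude constant): the fluctuation of the field
around its zero mode is controlled by the gradient energy,
`Σ_p (φ_p − θ̄(φ)_{p.2})² ≤ (V k) (dN)² Σ (∇φ)²`, `θ̄_a = V⁻¹ Σ_x φ(x,a)`, `V = N^d`. [folklore] -/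
theorem torus_poincare :
    ∀ (d N k : ℕ) [NeZero N] (φ : LatticeSineGordon.Config d N k), ∑ p : TorusSite d N × Fin k, (φ p - (Fintype.card (TorusSite d N) : ℝ)⁻¹ * ∑ y : TorusSite d N, φ (y, p.2)) ^ 2 ≤ (Fintype.card (TorusSite d N) * k) * (((d : ℝ) * N) ^ 2 * ∑ z : TorusSite d N, ∑ j : Fin d, ∑ a' : Fin k, (φ (z + Pi.single j 1, a') - φ (z, a')) ^ 2) := by
  intro d N k _ φ
  set G : ℝ := ∑ z : TorusSite d N, ∑ j : Fin d, ∑ a' : Fin k, (φ (z + Pi.single j 1, a') - φ (z, a')) ^ 2 with hG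
  set V : ℝ := (Fintype.card (TorusSite d N) : ℝ) with hV
  have hVpos : 0 < V := by
    rw [hV]; exact_mod_cast Fintype.card_pos
  have hterm : ∀ p : TorusSite d N × Fin k, (φ p - V⁻¹ * ∑ y : TorusSite d N, φ (y, p.2)) ^ 2 ≤ ((d : ℝ) * N) ^ 2 * G := by
    rintro ⟨x, a⟩
    have hmean : φ (x, a) - V⁻¹ * ∑ y : TorusSite d N, φ (y, a) = V⁻¹ * ∑ y : TorusSite d N, (φ (x, a) - φ (y, a)) := by
      rw [Finset.sum_sub_distrib, Finset.sum_const, Finset.card_univ, nsmul_eq_mul, ← hV]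
      field_simp
    rw [hmean, mul_pow]
    have hcs : (∑ y : TorusSite d N, (φ (x, a) - φ (y, a))) ^ 2 ≤ V * ∑ y : TorusSite d N, (φ (x, a) - φ (y, a)) ^ 2 := by
      have := sq_sum_le_card_mul_sum_sq (s := (Finset.univ : Finset (TorusSite d N))) (f := fun y => φ (x, a) - φ (y, a))
      rwa [Finset.card_univ, ← hV] at this
    have hdiff : ∑ y : TorusSite d N, (φ (x, a) - φ (y, a)) ^ 2 ≤ V * (((d : ℝ) * N) ^ 2 * G) := by
      calc ∑ y : TorusSite d N, (φ (x, a) - φ (y, a)) ^ 2 ≤ ∑ _y : TorusSite d N, ((d : ℝ) * N) ^ 2 * G :=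
            Finset.sum_le_sum fun y _ => by
              have := torus_diff_sq_le d N k φ y x a
              rwa [hG]
        _ = V * (((d : ℝ) * N) ^ 2 * G) := by rw [Finset.sum_const, Finset.card_univ, nsmul_eq_mul, ← hV]
    calc V⁻¹ ^ 2 * (∑ y : TorusSite d N, (φ (x, a) - φ (y, a))) ^ 2 ≤ V⁻¹ ^ 2 * (V * (V * (((d : ℝ) * N) ^ 2 * G))) := by
          gcongr
          exact hcs.trans (mul_le_mul_of_nonneg_left hdiff hVpos.le)
      _ = ((d : ℝ) * N) ^ 2 * G := by field_simp
  calc ∑ p : TorusSite d N × Fin k, (φ p - V⁻¹ * ∑ y : TorusSite d N, φ (y, p.2)) ^ 2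
      ≤ ∑ _p : TorusSite d N × Fin k, ((d : ℝ) * N) ^ 2 * G := Finset.sum_le_sum fun p _ => hterm p
    _ = (V * k) * (((d : ℝ) * N) ^ 2 * G) := by
        rw [Finset.sum_const, Finset.card_univ, Fintype.card_prod, Fintype.card_fin, nsmul_eq_mul]
        push_cast
        rw [← hV]

/-- **Variance identity for the zero mode**: `Σ_p φ_p² − V⁻¹ Σ_a (Σ_x φ(x,a))² = Σ_p (φ_p − θ̄_{p.2})²`
(`θ̄_a = V⁻¹ Σ_x φ(x,a)`): the regulator splits exactly into its zero-mode part `ε V |θ̄|²` and its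
fluctuation part. [folklore] -/
theorem sum_sq_sub_zeroMode :
    ∀ (d N k : ℕ) [NeZero N] (φ : LatticeSineGordon.Config d N k), ∑ p : TorusSite d N × Fin k, φ p ^ 2 - (Fintype.card (TorusSite d N) : ℝ)⁻¹ * ∑ a : Fin k, (∑ x : TorusSite d N, φ (x, a)) ^ 2 = ∑ p : TorusSite d N × Fin k, (φ p - (Fintype.card (TorusSite d N) : ℝ)⁻¹ * ∑ y : TorusSite d N, φ (y, p.2)) ^ 2 := by
  intro d N k _ φ
  set V : ℝ := (Fintype.card (TorusSite d N) : ℝ) with hV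
  have hVpos : 0 < V := by
    rw [hV]; exact_mod_cast Fintype.card_pos
  rw [Fintype.sum_prod_type, Fintype.sum_prod_type, Finset.sum_comm (f := fun x a => φ (x, a) ^ 2),
    Finset.sum_comm (f := fun x a => (φ (x, a) - V⁻¹ * ∑ y : TorusSite d N, φ (y, a)) ^ 2),
    Finset.mul_sum, ← Finset.sum_sub_distrib]
  refine Finset.sum_congr rfl fun a _ => ?_
  set s : ℝ := ∑ x : TorusSite d N, φ (x, a) with hs
  have hexp : ∀ x : TorusSite d N, (φ (x, a) - V⁻¹ * s) ^ 2 = φ (x, a) ^ 2 - 2 * V⁻¹ * s * φ (x, a) + (V⁻¹ * s) ^ 2 := by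
    intro x; ring
  simp_rw [hexp]
  rw [Finset.sum_add_distrib, Finset.sum_sub_distrib, ← Finset.mul_sum, ← hs, Finset.sum_const, Finset.card_univ,
    nsmul_eq_mul, ← hV]
  field_simp
  ring

end Summit.QuantumFields.YangMills.Theorems.AnchorGap

end
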